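import Summits.NavierStokesRegularity.NavierStokesRegularity.Theses.PalasekTowerBreakdown
import Summits.NavierStokesRegularity.FluidComputer.PalasekTowerRescaledCopyDelta

/-! **v2.6 (line owner ns-blowup-fc-route; design g2 2026-08-26T10:33Z, registration g3) = v2.5 OVER TREE NAMES.** The δ-vocabulary
module `FluidComputer/PalasekTowerRescaledCopyDelta.lean` is IN THE TREE (p439249, fc-prover-2 g4, ACCEPTED 2026-08-26T10:50:53Z, commit
b1b7ac281c76; re-homed onto `PalasekTowerRescaledCopyTolerance.lean` p438890 for `CaptureAtδ`, every other FQN verbatim = HOME port file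
425ef9179acbc00d). This file REPLACES v2.4 ccdd7a6786b16b95 as the registered skeleton of item stmt-NavierStokesRegularity-19178 after the
STATUS announce of record (SUCCESSOR-CHECKLIST ADDENDUM g2, EVENT P); v2.4 is kept as `lines/fc-oneshot.v24.lean`.

# Line `fc-oneshot` v2.6 — the K58 re-cut: seed at the first autonomous hand-over `(2,3)`, tolerance `δ = 1/3`

Crux: `EpisodeInduction` (item stmt-NavierStokesRegularity-19178, route PalasekTowerBreakdown). Design = v2.5 (K58 (3)+(4) adopted,
ns-blowup STATUS l.3278; DRAFT 0c87f604c91159d1 with line-local vocabulary) with the three parametrised statements now TREE names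
(`CaptureAtδ`, `GateCopyAt`, `RenormaliseFrom` in `PalasekTowerRescaledCopyDelta.lean`).

STUBS: `stub_heredityAtOne` (UNCHANGED since v2.2 = child item 19249 BY NAME) · `stub_gateCopyAtTwo : GateCopyAt 2 (1/3)` («DSS onset at
the first autonomous hand-over»: every registered level-2 stage extends to a registered level-3 stage whose τ₃-letter is a 1/3-copy of its
τ₂-letter; ⊇ `HeredityAt 2`) · `stub_renormaliseFromThree : RenormaliseFrom 3 (1/3)` (LOAD-BEARING: the robust one-shot gate ON the
1/3-alphabet, uniformly in k ≥ 3). COMPOSITION `EpisodeInduction_of` = tree theorem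
`episodeInductionG_of_heredityAtOne_gateCopyAt_two_renormaliseFrom_three` (seed by `Stage.extends_velocity_eq`, propagation by
`CaptureAtδ.succ_of_renormaliseFrom`, extension by `Stage.exists_extends_iff_runs_letter`; no named fact, aside 19180 not imported).
LOSSLESSNESS (tree `gateCopyAt_and_renormaliseFrom_iff`): stubs 2 ∧ 3 ⟺ `HeredityFrom 2 ∧ ∀ k ≥ 3, CaptureAtδ k (1/3)` — the line asserts,
beyond the N1 split, exactly «alphabet closure from level 3 at tolerance 1/3» (a constraint atom: refutable by ONE registered stage).

WHAT THIS IS NOT: not NS — OPEN sorried stubs + imported tree bookkeeping; nothing asserted; no stage, copy or tower claimed.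
-/

-- `Summit.<Summit>.<Problem>` is the tree's mandated summit-side namespace; the duplicate is deliberate.
set_option linter.dupNamespace false

noncomputable section

namespace Summit.NavierStokesRegularity.NavierStokesRegularity.Cruxes.EpisodeInduction.FcOneshot

open Summit.NavierStokesRegularity.FluidComputer
open Summit.NavierStokesRegularity.FluidComputer.PalasekTowerClayBridge

/-! ## The stubs -/

/-- stub (UNCHANGED since v2.2): the first gate `1 → 2` IS the child item `HeredityAtOne` (stmt-…-19249) by name. -/
theorem stub_heredityAtOne :
    _root_.Summit.NavierStokesRegularity.NavierStokesRegularity.Theses.PalasekTowerBreakdown.HeredityAtOne := by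
  sorry

/-- stub (SEED, K58 (4)): DSS onset at the first AUTONOMOUS hand-over `(2,3)` at tolerance `1/3`. -/
theorem stub_gateCopyAtTwo :
    _root_.Summit.NavierStokesRegularity.FluidComputer.PalasekTowerClayBridge.GateCopyAt 2 (1 / 3) := by
  sorry

/-- stub (LOAD-BEARING, K58 (3)): the robust one-shot gate on the `1/3`-alphabet, uniformly in `k ≥ 3`. -/
theorem stub_renormaliseFromThree :
    _root_.Summit.NavierStokesRegularity.FluidComputer.PalasekTowerClayBridge.RenormaliseFrom 3 (1 / 3) := by
  sorry

/-! ## The skeleton theorem -/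

/-- **Line composition**: the crux `EpisodeInduction` BY NAME from the three stubs' statements (tree theorem). -/
theorem EpisodeInduction_of :
    _root_.Summit.NavierStokesRegularity.NavierStokesRegularity.Theses.PalasekTowerBreakdown.HeredityAtOne →
    _root_.Summit.NavierStokesRegularity.FluidComputer.PalasekTowerClayBridge.GateCopyAt 2 (1 / 3) →
    _root_.Summit.NavierStokesRegularity.FluidComputer.PalasekTowerClayBridge.RenormaliseFrom 3 (1 / 3) →
      _root_.Summit.NavierStokesRegularity.NavierStokesRegularity.Theses.PalasekTowerBreakdown.EpisodeInduction :=
  fun h₁ hG hR => episodeInductionG_of_heredityAtOne_gateCopyAt_two_renormaliseFrom_three h₁ hG hR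

/-- The same, with the stubs plugged in. -/
theorem EpisodeInduction_holds_of_stubs :
    _root_.Summit.NavierStokesRegularity.NavierStokesRegularity.Theses.PalasekTowerBreakdown.EpisodeInduction :=
  EpisodeInduction_of stub_heredityAtOne stub_gateCopyAtTwo stub_renormaliseFromThree

/-! ## Kernel records -/

/-- The cut FACTORS THROUGH THE N1 SPLIT: stubs 2 + 3 prove the CHILD item `HeredityFromTwo` (stmt-…-19250) by name. -/
theorem HeredityFromTwo_of :
    _root_.Summit.NavierStokesRegularity.FluidComputer.PalasekTowerClayBridge.GateCopyAt 2 (1 / 3) →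
    _root_.Summit.NavierStokesRegularity.FluidComputer.PalasekTowerClayBridge.RenormaliseFrom 3 (1 / 3) →
      _root_.Summit.NavierStokesRegularity.NavierStokesRegularity.Theses.PalasekTowerBreakdown.HeredityFromTwo :=
  fun hG hR => heredityFrom_two_of_gateCopyAt_two_renormaliseFrom_three hG hR

/-- What the line asserts beyond the N1 split: alphabet closure from level 3 at tolerance 1/3 (losslessness). -/
example : GateCopyAt 2 (1 / 3) ∧ RenormaliseFrom 3 (1 / 3) ↔ HeredityFrom 2 ∧ ∀ k : ℕ, 3 ≤ k → CaptureAtδ k (1 / 3) :=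
  gateCopyAt_and_renormaliseFrom_iff le_rfl

/-- The seed contains the `k = 2` instance of the child item `HeredityFrom 2`. -/
example (hG : GateCopyAt 2 (1 / 3)) : HeredityAt 2 := hG.heredityAt

/-- The v2.4 `2/3`-capture is recovered at every level `k ≥ 3` (monotonicity in δ). -/
example (hG : GateCopyAt 2 (1 / 3)) (hR : RenormaliseFrom 3 (1 / 3)) {k : ℕ} (hk : 3 ≤ k) : CaptureAt k :=
  captureAt_of_gateCopyAt_two_renormaliseFrom_three_third hG hR hk

end Summit.NavierStokesRegularity.NavierStokesRegularity.Cruxes.EpisodeInduction.FcOneshot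

end
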